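import Literature.InformationTheory.QuantumCodes.UnionFindDecoder
import Literature.InformationTheory.QuantumCodes.ToricCodeDistance
import HarnessLib

/-!
# The Union-Find decoder corrects `t` erasures and `s` errors on the toric code when `t + 2s < L`

Topic `Literature/InformationTheory/QuantumCodes` (qec cell, LIT-2 lane «MWPM / union-find», LADDER-QEC Q4
"decoder as a FUNCTION with a certified correction radius"). Everything here is PROVED (no named fact, no
sorry); the objects (Algorithm 1 as a half-link growth process, `IsOutput`, `ufDecoder`) are those of
`UnionFindDecoder.lean`.

[DN21] N. Delfosse, N. H. Nickerson, *Almost-linear time decoding algorithm for topological codes*, Quantum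
5 (2021) 595, arXiv:1709.06218, §3: "Theorem 1. If `t + 2s < d`, Algorithm 1 can correct any combination of
`t` erased qubits and `s` `Z`-error." We prove it for the `L × L` toric code (`d = L`,
`ToricCode.cycle_weight_ge_holds`):

* `DelfosseNickerson2021_theorem1_toric` — for an erasure `R` and an error chain `e` with
  `|R| + 2·|supp e \ R| < L`, EVERY valid output `C` of Algorithm 1 (`UnionFind.IsOutput (∂e) R C`: any
  chain inside the grown erasure with the observed syndrome, i.e. every peeling choice) satisfies
  `e + C ∈ boundaries L`;
* `ufDecoder_corrects`, `ufDecoder_correctsUpTo`, `ufDecoder_isCorrectionRadius` — the decoder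
  `ufDecoder R` corrects every such error; without erasure it corrects every `Z`-error of weight
  `≤ ⌊(L-1)/2⌋`, which is the optimal radius (`ToricCode.optimalRadiusZ`; DN21 §3 ¶2).

## The printed proof and the proof given here

DN21's proof (§3, one paragraph): (a) a cluster grows only while it contains an odd number of syndrome
vertices, so some path of the error `E_Z` leaves it and "when a cluster grows, at least one new half-edge of
`E_Z` is covered"; (b) "after at most `2s` rounds of growth, the grown cluster covers the entire error `E_Z`
… the diameter of the largest erased cluster is at most `2s` edges", plus `t` for the erasure, `< d`, so the
peeling decoder cannot produce a logical error. Step (a) is `exists_new_errHalf` below. Step (b) is NOT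
true as printed for the synchronous Algorithm 1 — on the `13 × 13` torus the error made of the two parallel
3-link paths `{((k,0),0)}_{k<3} ∪ {((k,1),0)}_{k<3}` halts after ONE round with the grown erasure equal to
the two vertical links `((0,0),1)`, `((3,0),1)`, which does not cover `E_Z` (decoding nevertheless succeeds:
`e + C` bounds three plaquettes) — so we replace the covering/diameter sentence by an accounting argument
that proves the same conclusion for every peeling choice. Delfosse–Hastings 2021 (arXiv:2009.14226, Lemma 1,
p. 8; error-only case, augmented surface codes) sketch exactly such an accounting — "a single step of the growth
will cover half of one of the [hidden error] edges, and will increase the SUM of cluster diameters by at most 1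
… it is possible at this point that not all [hidden] edges are covered … the sum of the cluster diameters plus
the sum of the lengths of these paths is bounded by … w; if w is smaller than the surface code distance, it
decodes correctly" — which the instance above does not defeat (diameters `1 + 1`, uncovered paths `3 + 3`,
total `8 ≤ 2s = 12 < 13`). Steps 1–5 are that sum-of-extents accounting made precise (per-axis labels for the
diameters, credits for the covered error halves, the sum over ALL clusters for the merges), with the
synchronisation (step 1) that the synchronous rounds of Algorithm 2 need so that two odd clusters are never
credited for the same half (DH21 grow one sub-edge at a time), and with erasures:

1. **Synchronisation** (`SyncInv`, `syncInv_state`; DN21 Algorithm 2's support table `0 → 1/2 → 1`): after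
   every round all sites of odd clusters are of one type — all *near* (no own half on their non-full links)
   or all *far* (own half on every non-full link) — and every even cluster is pure; a round flips the type of
   the acting sites (`farType_step_of_near`, `isFull_step_of_far`), and an even cluster can only be fused
   through a site of the matching type (`exists_exit`, `farType_of_touched_near`, `nearType_of_touched_far`).
2. **Credit** (`exists_errLink_of_charge_eq_one`, `exists_new_errHalf`): the charge of a cluster is the
   parity of the number of error links with exactly one end in it, so every odd cluster grows, in every
   round, a NEW half of an un-erased error link.
3. **Seams** (`InArc`, `inArc_iff_of_mem_comp`): if no full axis-`i` link of a cluster has its tail in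
   column `a` or `a'`, the cluster lies in one arc of `ℤ_L` cut at `a, a'`; hence (`lab_eq_of_new`) an odd
   cluster acquires per round at most ONE new axis-`i` label `(column, side)` of each side.
4. **Potential** (`PotInv`, `potInv_of_round`, `potInv_state`): for every cluster `K` and axis `i`,
   `#labelsᵢ(K) ≤ 2·credit(K) + 2·erasedᵢ(K)` (grown halves of un-erased error links at sites of `K`;
   erased axis-`i` links in `K`), by induction over the rounds, summing over the old clusters fused into a
   new one.
5. **Conclusion**: if `e + C` were a non-trivial cycle it would contain an axis-`i` link in EVERY line
   `{v i = a}` (`ToricCode.forall_col_or_forall_row_of_not_mem_boundaries`, DKLP02 §4.3); each such link is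
   full or an un-erased error link, giving `2L` distinct probe halves, each either a label of some cluster
   or a bare half of an un-erased error link: `2L ≤ Σ_K #labelsᵢ(K) + (2s - G) ≤ 2G + 2t + 2s - G ≤ 4s + 2t`
   (`G ≤ 2s` grown error halves), contradicting `t + 2s < L`.

Scope (stated, not softened): the toric code without boundaries (DN21 state Theorem 1 for surface codes in
general); `s` counts the `Z`-errors OUTSIDE the erasure (errors on erased qubits are absorbed by the
erasure, as in the erasure channel); the weighted-growth and union–find data-structure refinements of DN21
§2 (Algorithm 2) change the complexity, not the grown clusters of Algorithm 1, and are not formalised.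

## References
[cite: DelfosseNickerson2021, §2 Algorithm 1, Algorithm 2; §3 Theorem 1 and its proof]
[cite: DennisEtAl2002, §3.1, §4.2–4.4 (toric code, chains, success criterion)]
[cite: DelfosseZemor2020, §2 (peeling decoder: any correction inside the erasure with the right syndrome)]
[cite: DelfosseHastings2021, Lemma 1 p. 8 (sum-of-diameters accounting, error-only case)]
-/

namespace Literature.InformationTheory.QuantumCodes

namespace ToricCode

namespace UnionFind

open Finset

variable {L : ℕ}

/-! ### Half-links: sites and coordinates -/

/-- The tail half of a link sits at its tail. [cite: DelfosseNickerson2021, §2 Algorithm 1 (half-edges)] -/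
@[simp] theorem vert_mk_false (ℓ : Edge L) : Half.vert (ℓ, false) = tail ℓ := by
  simp [Half.vert]

/-- The head half of a link sits at its head. [cite: DelfosseNickerson2021, §2 Algorithm 1 (half-edges)] -/
@[simp] theorem vert_mk_true (ℓ : Edge L) : Half.vert (ℓ, true) = head ℓ := by
  simp [Half.vert]

/-- A half sits at one of the slots of its own site. [cite: DennisEtAl2002, §3.1] -/
theorem mem_slots_vert (h : Half L) : h ∈ slots h.vert :=
  mem_slots_iff.2 rfl

/-- The `i`-th coordinate of the unit vector `eⱼ`. [cite: DennisEtAl2002, §3.1 (square lattice on the torus)] -/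
theorem dir_apply (i j : Fin 2) : (dir j : Vertex L) i = if i = j then 1 else 0 := by
  simp [dir, Pi.single_apply]

/-- The head of the link `(v, i)` has `i`-th coordinate `v i + 1`. [cite: DennisEtAl2002, §3.1] -/
theorem head_apply_self (v : Vertex L) (i : Fin 2) : head (v, i) i = v i + 1 := by
  simp [head, dir_apply]

/-- Moving along a link of the other axis does not change the `i`-th coordinate. [cite: DennisEtAl2002, §3.1] -/
theorem head_apply_of_ne (v : Vertex L) {i j : Fin 2} (hij : i ≠ j) : head (v, j) i = v i := by
  simp [head, dir_apply, hij]

/-! ### Site types: pending-near and pending-far -/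

/-- A site is of **near type** in the state `S` when it owns no grown half on any of its non-full slots (its
next action, if any, grows its OWN halves: support `0 → 1/2`). Complete sites (all four links full) are of
both types. [cite: DelfosseNickerson2021, §2 Algorithm 2 (Support table: value 0 on the boundary edges)] -/
def NearType (S : Finset (Half L)) (v : Vertex L) : Prop :=
  ∀ h ∈ slots v, ¬ IsFull S h.1 → h ∉ S

/-- A site is of **far type** in the state `S` when it owns the grown half on every one of its non-full slots
(its next action grows the FAR halves: support `1/2 → 1`). [cite: DelfosseNickerson2021, §2 Algorithm 2 (Support table: value 1/2 on the boundary edges)] -/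
def FarType (S : Finset (Half L)) (v : Vertex L) : Prop :=
  ∀ h ∈ slots v, ¬ IsFull S h.1 → h ∈ S

/-- A set of sites is **pure** when all its sites are of near type or all are of far type.
[cite: DelfosseNickerson2021, §2 Algorithm 2 (boundary list of a cluster)] -/
def Pure (S : Finset (Half L)) (K : Finset (Vertex L)) : Prop :=
  (∀ w ∈ K, NearType S w) ∨ (∀ w ∈ K, FarType S w)

/-- Far type is monotone in the state. [cite: DelfosseNickerson2021, §2 Algorithm 2 (Support only increases)] -/
theorem FarType.mono {S S' : Finset (Half L)} (hSS' : S ⊆ S') {v : Vertex L} (hv : FarType S v) :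
    FarType S' v :=
  fun h hh hfull => hSS' (hv h hh fun hf => hfull (hf.mono hSS'))

/-- Initially every site is of near type (only erased links carry halves, and they are full).
[cite: DelfosseNickerson2021, §2 Algorithm 1 (steps 1–2), Algorithm 2 (Support initialised to 0/1)] -/
theorem nearType_initial (R : Finset (Edge L)) (v : Vertex L) : NearType (initial R) v :=
  fun _ _ hfull hS => hfull (isFull_initial_iff.2 (mem_initial.1 hS))

variable [NeZero L]

/-- A charge is `0` or `1`. [cite: DelfosseNickerson2021, §2 Algorithm 1 (step 3: even / odd clusters)] -/
theorem charge_zero_or_one (σ : Syndrome L) (S : Finset (Half L)) (v : Vertex L) :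
    charge σ S v = 0 ∨ charge σ S v = 1 := by
  have h2 : ∀ x : ZMod 2, x = 0 ∨ x = 1 := by decide
  exact h2 _

/-- A half grown during a round was grown by a site of an odd cluster acting on a non-full slot.
[cite: DelfosseNickerson2021, §2 Algorithm 1 (steps 3–4)] -/
theorem exists_act_of_mem_step {σ : Syndrome L} {S : Finset (Half L)} {h : Half L} (hS' : h ∈ step σ S)
    (hS : h ∉ S) : ∃ v, charge σ S v = 1 ∧ ∃ h₀ ∈ slots v, ¬ IsFull S h₀.1 ∧ h = act S h₀ := by
  rcases mem_step.1 hS' with h' | ⟨v, hv, hg⟩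
  · exact absurd h' hS
  · obtain ⟨h₀, hh₀, rfl⟩ := Finset.mem_image.1 hg
    exact ⟨v, hv, h₀, (Finset.mem_filter.1 hh₀).1, (Finset.mem_filter.1 hh₀).2, rfl⟩

/-- In a round where every acting site is of near type, a new half is an own half of an acting site on a
link that was not full. [cite: DelfosseNickerson2021, §2 Algorithm 2 (Support 0 → 1/2)] -/
theorem near_new {σ : Syndrome L} {S : Finset (Half L)} (hN : ∀ v, charge σ S v = 1 → NearType S v)
    {h : Half L} (hS' : h ∈ step σ S) (hS : h ∉ S) : charge σ S h.vert = 1 ∧ ¬ IsFull S h.1 := by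
  obtain ⟨v, hv, h₀, hh₀, hfull, rfl⟩ := exists_act_of_mem_step hS' hS
  have h₀S : h₀ ∉ S := hN v hv h₀ hh₀ hfull
  rw [act, if_neg h₀S] at *
  exact ⟨by rwa [mem_slots_iff.1 hh₀], hfull⟩

/-- In a round where every acting site is of far type, a new half is the far half of a slot owned by an
acting site on a link that was not full. [cite: DelfosseNickerson2021, §2 Algorithm 2 (Support 1/2 → 1)] -/
theorem far_new {σ : Syndrome L} {S : Finset (Half L)} (hF : ∀ v, charge σ S v = 1 → FarType S v)
    {h : Half L} (hS' : h ∈ step σ S) (hS : h ∉ S) :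
    charge σ S h.other.vert = 1 ∧ h.other ∈ S ∧ ¬ IsFull S h.1 := by
  obtain ⟨v, hv, h₀, hh₀, hfull, rfl⟩ := exists_act_of_mem_step hS' hS
  have h₀S : h₀ ∈ S := hF v hv h₀ hh₀ hfull
  rw [act, if_pos h₀S] at *
  rw [Half.other_other, Half.other_fst, mem_slots_iff.1 hh₀]
  exact ⟨hv, h₀S, hfull⟩

/-- **First exit.** If the cluster of `w` has grown from `S` to `S' ⊇ S`, some site of the old cluster is an
end of a link that is full in `S'` but not in `S`. [cite: DelfosseNickerson2021, §2 Algorithm 1 (step 5: clusters fuse along newly covered edges)] -/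
theorem exists_exit {S S' : Finset (Half L)} {w u : Vertex L} (hu : u ∈ comp S' w)
    (hu' : u ∉ comp S w) : ∃ x ∈ comp S w, ∃ h : Half L, h.vert = x ∧ IsFull S' h.1 ∧ ¬ IsFull S h.1 := by
  obtain ⟨p⟩ := mem_comp.1 hu
  suffices aux : ∀ {a b : Vertex L} (_ : (fullGraph S').Walk a b), a ∈ comp S w → b ∉ comp S w →
      ∃ x ∈ comp S w, ∃ h : Half L, h.vert = x ∧ IsFull S' h.1 ∧ ¬ IsFull S h.1 from
    aux p (mem_comp_self S w) hu'
  intro a b p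
  induction p with
  | nil => exact fun ha hb => absurd ha hb
  | cons hadj p ih =>
    rename_i a c _
    intro ha hb
    by_cases hc : c ∈ comp S w
    · exact ih hc hb
    · obtain ⟨-, ℓ, hℓ', hor⟩ := hadj
      have hℓ : ¬ IsFull S ℓ := by
        intro hℓ
        apply hc
        rw [mem_comp] at ha ⊢
        rcases hor with ⟨rfl, rfl⟩ | ⟨rfl, rfl⟩
        · exact ha.trans (reachable_tail_head hℓ)
        · exact ha.trans (reachable_tail_head hℓ).symm
      rcases hor with ⟨hta, -⟩ | ⟨-, hha⟩
      · exact ⟨a, ha, (ℓ, false), by simp [hta], hℓ', hℓ⟩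
      · exact ⟨a, ha, (ℓ, true), by simp [hha], hℓ', hℓ⟩

/-- In a near-type round an acting site becomes of far type. [cite: DelfosseNickerson2021, §2 Algorithm 2 (Support 0 → 1/2 on all boundary edges)] -/
theorem farType_step_of_near {σ : Syndrome L} {S : Finset (Half L)} {v : Vertex L} (hv : charge σ S v = 1)
    (hN : NearType S v) : FarType (step σ S) v := by
  intro h hh hfull
  have hfullS : ¬ IsFull S h.1 := fun hf => hfull (hf.mono (subset_step σ S))
  rw [mem_step]
  refine Or.inr ⟨v, hv, Finset.mem_image.2 ⟨h, Finset.mem_filter.2 ⟨hh, hfullS⟩, ?_⟩⟩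
  rw [act, if_neg (hN h hh hfullS)]

/-- In a far-type round an acting site becomes complete (every slot full), hence of both types.
[cite: DelfosseNickerson2021, §2 Algorithm 2 (Support 1/2 → 1 on all boundary edges)] -/
theorem isFull_step_of_far {σ : Syndrome L} {S : Finset (Half L)} {v : Vertex L} (hv : charge σ S v = 1)
    (hF : FarType S v) {h : Half L} (hh : h ∈ slots v) : IsFull (step σ S) h.1 := by
  by_cases hfull : IsFull S h.1
  · exact hfull.mono (subset_step σ S)
  · have hS : h ∈ S := hF h hh hfull
    refine isFull_iff_mem_and_other_mem.2 ⟨subset_step σ S hS, ?_⟩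
    rw [mem_step]
    refine Or.inr ⟨v, hv, Finset.mem_image.2 ⟨h, Finset.mem_filter.2 ⟨hh, hfull⟩, ?_⟩⟩
    rw [act, if_pos hS]

/-- In a near-type round a non-acting site of near type stays of near type. [cite: DelfosseNickerson2021, §2 Algorithm 1 (only odd clusters grow)] -/
theorem nearType_step_of_near {σ : Syndrome L} {S : Finset (Half L)} (hN : ∀ v, charge σ S v = 1 → NearType S v)
    {v : Vertex L} (hv : charge σ S v ≠ 1) (hn : NearType S v) : NearType (step σ S) v := by
  intro h hh hfull hS'
  have hfullS : ¬ IsFull S h.1 := fun hf => hfull (hf.mono (subset_step σ S))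
  have h1 := (near_new hN hS' (hn h hh hfullS)).1
  rw [mem_slots_iff.1 hh] at h1
  exact hv h1

/-- In a far-type round every site of near type stays of near type. [cite: DelfosseNickerson2021, §2 Algorithm 2 (Support 1/2 → 1 fills the edge)] -/
theorem nearType_step_of_far {σ : Syndrome L} {S : Finset (Half L)} (hF : ∀ v, charge σ S v = 1 → FarType S v)
    {v : Vertex L} (hn : NearType S v) : NearType (step σ S) v := by
  intro h hh hfull hS'
  have hfullS : ¬ IsFull S h.1 := fun hf => hfull (hf.mono (subset_step σ S))
  have h2 := (far_new hF hS' (hn h hh hfullS)).2.1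
  exact hfull (isFull_iff_mem_and_other_mem.2 ⟨hS', subset_step σ S h2⟩)

/-- In a near-type round, an even cluster that gets fused to something was of far type.
[cite: DelfosseNickerson2021, §2 Algorithm 1 (step 5) with Algorithm 2 (Support table)] -/
theorem farType_of_touched_near {σ : Syndrome L} {S : Finset (Half L)} (hinv : ∀ v, charge σ S v = 0 → Pure S (comp S v))
    (hN : ∀ v, charge σ S v = 1 → NearType S v) {w u : Vertex L} (hw : charge σ S w = 0)
    (hu : u ∈ comp (step σ S) w) (hu' : u ∉ comp S w) : FarType S w := by
  obtain ⟨x, hx, h, hhx, hfull', hfull⟩ := exists_exit hu hu'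
  have hS : h ∈ S := by
    by_contra hS
    have h1 := (near_new hN (isFull_iff_mem_and_other_mem.1 hfull').1 hS).1
    rw [hhx, charge_eq_of_mem_comp hx, hw] at h1
    exact zero_ne_one h1
  have hxn : ¬ NearType S x := fun hxn => hxn h (hhx ▸ mem_slots_vert h) hfull hS
  rcases hinv w hw with hnear | hfar
  · exact absurd (hnear x hx) hxn
  · exact hfar w (mem_comp_self S w)

/-- In a far-type round, an even cluster that gets fused to something was of near type.
[cite: DelfosseNickerson2021, §2 Algorithm 1 (step 5) with Algorithm 2 (Support table)] -/
theorem nearType_of_touched_far {σ : Syndrome L} {S : Finset (Half L)} (hinv : ∀ v, charge σ S v = 0 → Pure S (comp S v))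
    (hF : ∀ v, charge σ S v = 1 → FarType S v) {w u : Vertex L} (hw : charge σ S w = 0)
    (hu : u ∈ comp (step σ S) w) (hu' : u ∉ comp S w) : NearType S w := by
  obtain ⟨x, hx, h, hhx, hfull', hfull⟩ := exists_exit hu hu'
  have hS : h ∉ S := by
    intro hS
    have hoS : h.other ∉ S := fun hoS => hfull (isFull_iff_mem_and_other_mem.2 ⟨hS, hoS⟩)
    have hoS' : h.other ∈ step σ S := (isFull_iff_mem_and_other_mem.1 hfull').2
    have h1 := (far_new hF hoS' hoS).1
    rw [Half.other_other, hhx, charge_eq_of_mem_comp hx, hw] at h1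
    exact zero_ne_one h1
  have hxf : ¬ FarType S x := fun hxf => hS (hxf h (hhx ▸ mem_slots_vert h) hfull)
  rcases hinv w hw with hnear | hfar
  · exact hnear w (mem_comp_self S w)
  · exact absurd (hfar x hx) hxf

/-- **The synchronisation invariant** of Algorithm 1: all acting sites (sites of odd clusters) are of one
type — all near or all far — and every even cluster is pure. [cite: DelfosseNickerson2021, §2 Algorithm 2 (Support table and boundary lists)] -/
def SyncInv (σ : Syndrome L) (S : Finset (Half L)) : Prop :=
  ((∀ v, charge σ S v = 1 → NearType S v) ∨ (∀ v, charge σ S v = 1 → FarType S v)) ∧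
    ∀ v, charge σ S v = 0 → Pure S (comp S v)

/-- If a cluster did not change in a round, neither did its charge. [cite: DelfosseNickerson2021, §2 Algorithm 1 (step 3)] -/
theorem charge_step_of_comp_eq {σ : Syndrome L} {S : Finset (Half L)} {w : Vertex L}
    (h : comp (step σ S) w = comp S w) : charge σ (step σ S) w = charge σ S w := by
  rw [charge, charge, h]

/-- A site that acted or whose cluster changed in the round. [cite: DelfosseNickerson2021, §2 Algorithm 1 (steps 4–5)] -/
theorem acted_or_touched {σ : Syndrome L} {S : Finset (Half L)} {v w : Vertex L} (hw : w ∈ comp (step σ S) v)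
    (hno : ¬ ∃ w ∈ comp (step σ S) v, charge σ S w = 0 ∧ comp (step σ S) w = comp S w) :
    charge σ S w = 1 ∨ ∃ u ∈ comp (step σ S) w, u ∉ comp S w := by
  rcases charge_zero_or_one σ S w with h0 | h1
  · right
    by_contra hcon
    push Not at hcon
    refine hno ⟨w, hw, h0, Finset.Subset.antisymm hcon (comp_mono (subset_step σ S) w)⟩
  · exact Or.inl h1

/-- **One round preserves the synchronisation invariant** (and flips the type of the acting sites).
[cite: DelfosseNickerson2021, §2 Algorithm 2 (Support table), §3 proof of Thm 1] -/
theorem syncInv_step {σ : Syndrome L} {S : Finset (Half L)} (hinv : SyncInv σ S) : SyncInv σ (step σ S) := by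
  obtain ⟨hN | hF, hpure⟩ := hinv
  · -- near-type round: acting sites and touched even clusters end up of far type
    have key : ∀ w, (charge σ S w = 1 ∨ ∃ u ∈ comp (step σ S) w, u ∉ comp S w) → FarType (step σ S) w := by
      rintro w (h1 | ⟨u, hu, hu'⟩)
      · exact farType_step_of_near h1 (hN w h1)
      · rcases charge_zero_or_one σ S w with h0 | h1
        · exact (farType_of_touched_near hpure hN h0 hu hu').mono (subset_step σ S)
        · exact farType_step_of_near h1 (hN w h1)
    refine ⟨Or.inr fun v hv => key v ?_, fun v hv => ?_⟩
    · by_contra hcon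
      push Not at hcon
      have heq : comp (step σ S) v = comp S v :=
        Finset.Subset.antisymm (fun u hu => hcon.2 u hu) (comp_mono (subset_step σ S) v)
      rw [charge_step_of_comp_eq heq] at hv
      exact hcon.1 hv
    · by_cases hex : ∃ w ∈ comp (step σ S) v, charge σ S w = 0 ∧ comp (step σ S) w = comp S w
      · obtain ⟨w, hw, hw0, hweq⟩ := hex
        rw [← comp_eq_comp_of_mem hw, hweq]
        have hna : ∀ w' ∈ comp S w, charge σ S w' ≠ 1 := fun w' hw' => by
          rw [charge_eq_of_mem_comp hw', hw0]; exact zero_ne_one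
        rcases hpure w hw0 with hn | hf
        · exact Or.inl fun w' hw' => nearType_step_of_near hN (hna w' hw') (hn w' hw')
        · exact Or.inr fun w' hw' => (hf w' hw').mono (subset_step σ S)
      · exact Or.inr fun w hw => key w (acted_or_touched hw hex)
  · -- far-type round: acting sites become complete, touched even clusters were of near type
    have key : ∀ w, (charge σ S w = 1 ∨ ∃ u ∈ comp (step σ S) w, u ∉ comp S w) → NearType (step σ S) w := by
      rintro w (h1 | ⟨u, hu, hu'⟩)
      · exact fun h hh hfull => absurd (isFull_step_of_far h1 (hF w h1) hh) hfull
      · rcases charge_zero_or_one σ S w with h0 | h1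
        · exact nearType_step_of_far hF (nearType_of_touched_far hpure hF h0 hu hu')
        · exact fun h hh hfull => absurd (isFull_step_of_far h1 (hF w h1) hh) hfull
    refine ⟨Or.inl fun v hv => key v ?_, fun v hv => ?_⟩
    · by_contra hcon
      push Not at hcon
      have heq : comp (step σ S) v = comp S v :=
        Finset.Subset.antisymm (fun u hu => hcon.2 u hu) (comp_mono (subset_step σ S) v)
      rw [charge_step_of_comp_eq heq] at hv
      exact hcon.1 hv
    · by_cases hex : ∃ w ∈ comp (step σ S) v, charge σ S w = 0 ∧ comp (step σ S) w = comp S w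
      · obtain ⟨w, hw, hw0, hweq⟩ := hex
        rw [← comp_eq_comp_of_mem hw, hweq]
        rcases hpure w hw0 with hn | hf
        · exact Or.inl fun w' hw' => nearType_step_of_far hF (hn w' hw')
        · exact Or.inr fun w' hw' => (hf w' hw').mono (subset_step σ S)
      · exact Or.inl fun w hw => key w (acted_or_touched hw hex)

/-- The synchronisation invariant holds initially. [cite: DelfosseNickerson2021, §2 Algorithm 1 (steps 1–2)] -/
theorem syncInv_initial (σ : Syndrome L) (R : Finset (Edge L)) : SyncInv σ (initial R) :=
  ⟨Or.inl fun v _ => nearType_initial R v, fun _ _ => Or.inl fun w _ => nearType_initial R w⟩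

/-- **The synchronisation invariant holds after every round.** [cite: DelfosseNickerson2021, §2 Algorithm 2, §3 proof of Thm 1] -/
theorem syncInv_state (σ : Syndrome L) (R : Finset (Edge L)) : ∀ n, SyncInv σ (state σ R n)
  | 0 => syncInv_initial σ R
  | n + 1 => by rw [state_succ]; exact syncInv_step (syncInv_state σ R n)


/-! ### Seams: two forbidden columns confine a cluster to an arc -/

/-- `c` lies on the arc `a+1, a+2, …, a'` of the cycle `ℤ_L` (positions measured from `a`).
[cite: DelfosseNickerson2021, §3 proof of Thm 1 (diameter of the clusters along a logical cycle)] -/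
def InArc (a a' c : ZMod L) : Prop :=
  1 ≤ (c - a).val ∧ (c - a).val ≤ (a' - a).val

/-- Two distinct residues force `L ≥ 2`. [folklore] -/
private theorem one_lt_of_ne {a a' : ZMod L} (h : a ≠ a') : 1 < L := by
  by_contra hL
  have hL1 : L = 1 := by have := NeZero.ne L; omega
  apply h
  apply ZMod.val_injective L
  have ha := ZMod.val_lt a
  have ha' := ZMod.val_lt a'
  omega

/-- One step along the cycle: `((c + 1) - a).val = ((c - a).val + 1) mod L`. [folklore] -/
private theorem val_add_one_sub {a c : ZMod L} (hL : 1 < L) : (c + 1 - a).val = ((c - a).val + 1) % L := by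
  haveI : Fact (1 < L) := ⟨hL⟩
  rw [show c + 1 - a = (c - a) + 1 by ring, ZMod.val_add, ZMod.val_one]

omit [NeZero L] in
/-- The base point `a` is not on the arc. [cite: DelfosseNickerson2021, §3 proof of Thm 1] -/
theorem not_inArc_left (a a' : ZMod L) : ¬ InArc a a' a := by
  simp [InArc]

omit [NeZero L] in
/-- The end point `a'` is on the arc. [cite: DelfosseNickerson2021, §3 proof of Thm 1] -/
theorem inArc_right {a a' : ZMod L} (h : a ≠ a') : InArc a a' a' := by
  refine ⟨Nat.one_le_iff_ne_zero.2 fun h0 => h ?_, le_rfl⟩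
  rw [ZMod.val_eq_zero, sub_eq_zero] at h0
  exact h0.symm

/-- The point after the base point is on the arc. [cite: DelfosseNickerson2021, §3 proof of Thm 1] -/
theorem inArc_left_add_one {a a' : ZMod L} (h : a ≠ a') : InArc a a' (a + 1) := by
  have hL := one_lt_of_ne h
  have h1 : (a + 1 - a).val = 1 := by
    rw [val_add_one_sub hL, sub_self, ZMod.val_zero, Nat.mod_eq_of_lt hL]
  refine ⟨by rw [h1], ?_⟩
  rw [h1]
  exact (inArc_right h).1

/-- The point after the end point is not on the arc. [cite: DelfosseNickerson2021, §3 proof of Thm 1] -/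
theorem not_inArc_right_add_one (a a' : ZMod L) : ¬ InArc a a' (a' + 1) := by
  rintro ⟨h1, h2⟩
  by_cases haa : a = a'
  · subst haa
    rcases Nat.lt_or_ge 1 L with hL | hL
    · rw [val_add_one_sub hL, sub_self, ZMod.val_zero] at h2
      rw [Nat.mod_eq_of_lt hL] at h2
      simp at h2
    · have := ZMod.val_lt (a + 1 - a)
      omega
  · have hL := one_lt_of_ne haa
    rw [val_add_one_sub hL] at h1 h2
    have hm := ZMod.val_lt (a' - a)
    rcases Nat.lt_or_ge ((a' - a).val + 1) L with hlt | hge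
    · rw [Nat.mod_eq_of_lt hlt] at h2
      omega
    · have heq : (a' - a).val + 1 = L := by omega
      rw [heq, Nat.mod_self] at h1
      omega

/-- Crossing a seam other than the two forbidden ones does not change arc membership.
[cite: DelfosseNickerson2021, §3 proof of Thm 1] -/
theorem inArc_add_one_iff {a a' c : ZMod L} (hc : c ≠ a) (hc' : c ≠ a') :
    InArc a a' (c + 1) ↔ InArc a a' c := by
  have hL := one_lt_of_ne hc
  have hρ0 : (c - a).val ≠ 0 := by
    rw [Ne, ZMod.val_eq_zero, sub_eq_zero]; exact hc
  have hρm : (c - a).val ≠ (a' - a).val := fun h => hc' (by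
    have := ZMod.val_injective L h
    exact sub_left_injective this)
  have hρL := ZMod.val_lt (c - a)
  have hmL := ZMod.val_lt (a' - a)
  unfold InArc
  rw [val_add_one_sub hL]
  rcases Nat.lt_or_ge ((c - a).val + 1) L with hlt | hge
  · rw [Nat.mod_eq_of_lt hlt]; omega
  · have heq : (c - a).val + 1 = L := by omega
    rw [heq, Nat.mod_self]; omega

/-- **Seam lemma.** If no full axis-`i` link inside the cluster of `x` has its tail in column `a` or in
column `a'`, then the whole cluster lies on one side of the two seams: arc membership of the `i`-th
coordinate is constant on the cluster. [cite: DelfosseNickerson2021, §3 proof of Thm 1 (a cluster must span the cycle to cause a logical error)] -/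
theorem inArc_iff_of_mem_comp {S : Finset (Half L)} {i : Fin 2} {a a' : ZMod L} {x w : Vertex L}
    (hw : w ∈ comp S x)
    (hforbid : ∀ ℓ : Edge L, IsFull S ℓ → ℓ.2 = i → tail ℓ ∈ comp S x → ℓ.1 i ≠ a ∧ ℓ.1 i ≠ a') :
    InArc a a' (w i) ↔ InArc a a' (x i) := by
  obtain ⟨p⟩ := mem_comp.1 hw
  suffices aux : ∀ {b c : Vertex L} (_ : (fullGraph S).Walk b c), b ∈ comp S x →
      (InArc a a' (c i) ↔ InArc a a' (b i)) from aux p (mem_comp_self S x)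
  intro b c p
  induction p with
  | nil => exact fun _ => Iff.rfl
  | cons hadj p ih =>
    rename_i b d _
    intro hb
    have hd : d ∈ comp S x := mem_comp.2 ((mem_comp.1 hb).trans hadj.reachable)
    rw [ih hd]
    obtain ⟨-, ℓ, hℓ, hor⟩ := hadj
    rcases ℓ with ⟨t, j⟩
    -- the `i`-th coordinates of the two ends of `ℓ`
    have hti : tail (t, j) i = t i := rfl
    by_cases hji : j = i
    · subst hji
      have htail : tail (t, j) ∈ comp S x := by
        rcases hor with ⟨h1, -⟩ | ⟨h1, -⟩ <;> rw [h1] <;> assumption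
      obtain ⟨hta, hta'⟩ := hforbid (t, j) hℓ rfl htail
      have hhead : head (t, j) j = t j + 1 := head_apply_self t j
      rcases hor with ⟨h1, h2⟩ | ⟨h1, h2⟩
      · rw [← h1, ← h2, hti, hhead, inArc_add_one_iff hta hta']
      · rw [← h1, ← h2, hti, hhead, inArc_add_one_iff hta hta']
    · have hhead : head (t, j) i = t i := head_apply_of_ne t (Ne.symm hji)
      rcases hor with ⟨h1, h2⟩ | ⟨h1, h2⟩
      · rw [← h1, ← h2, hti, hhead]
      · rw [← h1, ← h2, hti, hhead]

/-! ### Odd clusters see an un-erased error link -/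

/-- The charge of a cluster for the syndrome of `e` is the number (mod 2) of error links with exactly
one end in the cluster; an odd cluster therefore has an error link with exactly one end in it.
[cite: DelfosseNickerson2021, §3 proof of Thm 1 ("a cluster is even as soon as it covers the errors it sees")] -/
theorem exists_errLink_of_charge_eq_one {e : Chain L} {S : Finset (Half L)} {x : Vertex L}
    (hodd : charge (syn L e) S x = 1) :
    ∃ ℓ : Edge L, e ℓ ≠ 0 ∧ ¬ (tail ℓ ∈ comp S x ↔ head ℓ ∈ comp S x) := by
  classical
  by_contra hcon
  push Not at hcon
  have he : e = ∑ ℓ, e ℓ • (Pi.single ℓ (1 : ZMod 2) : Chain L) := by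
    funext ℓ'
    simp [Finset.sum_apply, Pi.single_apply]
  have hlin : ∀ s, syn L e s = ∑ ℓ, e ℓ * syn L (Pi.single ℓ 1) s := by
    intro s
    conv_lhs => rw [he]
    unfold syn
    rw [Matrix.mulVec_sum]
    simp only [Finset.sum_apply, Matrix.mulVec_smul, Pi.smul_apply, smul_eq_mul]
  have hzero : charge (syn L e) S x = 0 := by
    unfold charge
    simp_rw [hlin, syn_single]
    rw [Finset.sum_comm]
    refine Finset.sum_eq_zero fun ℓ _ => ?_
    rw [← Finset.mul_sum, Finset.sum_add_distrib, Finset.sum_ite_eq' (comp S x) (tail ℓ),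
      Finset.sum_ite_eq' (comp S x) (head ℓ)]
    by_cases heℓ : e ℓ = 0
    · rw [heℓ, zero_mul]
    · have hiff := hcon ℓ heℓ
      by_cases ht : tail ℓ ∈ comp S x
      · rw [if_pos ht, if_pos (hiff.1 ht), show (1 : ZMod 2) + 1 = 0 from by decide, mul_zero]
      · rw [if_neg ht, if_neg (fun hh => ht (hiff.2 hh))]; simp
  rw [hzero] at hodd
  exact zero_ne_one hodd

/-- **Credit.** A site of an odd cluster acts on an un-erased, non-full ERROR link: the round grows a new
half on an error link outside the erasure. [cite: DelfosseNickerson2021, §3 proof of Thm 1 ("each round covers at least half an edge of the error")] -/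
theorem exists_new_errHalf {e : Chain L} {R : Finset (Edge L)} {S : Finset (Half L)}
    (hR : ∀ ℓ ∈ R, IsFull S ℓ) {x : Vertex L} (hodd : charge (syn L e) S x = 1) :
    ∃ u ∈ comp S x, ∃ h₀ ∈ slots u, e h₀.1 ≠ 0 ∧ h₀.1 ∉ R ∧ ¬ IsFull S h₀.1 ∧
      act S h₀ ∈ step (syn L e) S ∧ act S h₀ ∉ S := by
  obtain ⟨ℓ, heℓ, hiff⟩ := exists_errLink_of_charge_eq_one hodd
  have hfull : ¬ IsFull S ℓ := fun hf => hiff (tail_mem_comp_iff_head_mem_comp hf x)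
  have hℓR : ℓ ∉ R := fun hℓR => hfull (hR ℓ hℓR)
  have hgrow : ∀ u ∈ comp S x, ∀ h₀ ∈ slots u, h₀.1 = ℓ →
      act S h₀ ∈ step (syn L e) S ∧ act S h₀ ∉ S := by
    rintro u hu h₀ hh₀ rfl
    refine ⟨mem_step.2 (Or.inr ⟨u, ?_, Finset.mem_image.2 ⟨h₀, Finset.mem_filter.2 ⟨hh₀, hfull⟩, rfl⟩⟩),
      act_not_mem hfull⟩
    rw [charge_eq_of_mem_comp hu, hodd]
  by_cases ht : tail ℓ ∈ comp S x
  · exact ⟨tail ℓ, ht, (ℓ, false), mem_slots_iff.2 (vert_mk_false ℓ), heℓ, hℓR, hfull,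
      hgrow _ ht _ (mem_slots_iff.2 (vert_mk_false ℓ)) rfl⟩
  · have hh : head ℓ ∈ comp S x := by
      by_contra hh; exact hiff ⟨fun h => absurd h ht, fun h => absurd h hh⟩
    exact ⟨head ℓ, hh, (ℓ, true), mem_slots_iff.2 (vert_mk_true ℓ), heℓ, hℓR, hfull,
      hgrow _ hh _ (mem_slots_iff.2 (vert_mk_true ℓ)) rfl⟩

/-! ### Counting over a family of disjoint clusters -/

omit [NeZero L] in
/-- Summing, over pairwise disjoint sets of sites, the number of elements of `T` mapped into each set counts
every element of `T'` at most once. [folklore] -/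
private theorem sum_card_filter_mem_le {α : Type*} [DecidableEq α] (Ps : Finset (Finset (Vertex L)))
    (hdisj : ∀ P ∈ Ps, ∀ Q ∈ Ps, P ≠ Q → Disjoint P Q) (g : α → Vertex L) (T T' : Finset α)
    (hT : ∀ a ∈ T, ∀ P ∈ Ps, g a ∈ P → a ∈ T') :
    ∑ P ∈ Ps, (T.filter fun a => g a ∈ P).card ≤ T'.card := by
  rw [← Finset.card_biUnion]
  · refine Finset.card_le_card fun a ha => ?_
    obtain ⟨P, hP, ha⟩ := Finset.mem_biUnion.1 ha
    exact hT a (Finset.mem_filter.1 ha).1 P hP (Finset.mem_filter.1 ha).2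
  · intro P hP Q hQ hPQ
    refine Finset.disjoint_filter.2 fun a _ haP haQ => ?_
    exact Finset.disjoint_left.1 (hdisj P hP Q hQ hPQ) haP haQ

/-- Distinct clusters are disjoint. [cite: DelfosseNickerson2021, §2 Algorithm 1 (clusters = connected components)] -/
theorem disjoint_comp_of_ne {S : Finset (Half L)} {v w : Vertex L} (h : comp S v ≠ comp S w) :
    Disjoint (comp S v) (comp S w) :=
  Finset.disjoint_left.2 fun _ hxv hxw => h ((comp_eq_comp_of_mem hxv).symm.trans (comp_eq_comp_of_mem hxw))

/-- A family of clusters is pairwise disjoint. [cite: DelfosseNickerson2021, §2 Algorithm 1 (clusters = connected components)] -/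
theorem pairwiseDisjoint_image_comp (S : Finset (Half L)) (K : Finset (Vertex L)) :
    ∀ P ∈ K.image (comp S), ∀ Q ∈ K.image (comp S), P ≠ Q → Disjoint P Q := by
  intro P hP Q hQ hPQ
  obtain ⟨v, -, rfl⟩ := Finset.mem_image.1 hP
  obtain ⟨w, -, rfl⟩ := Finset.mem_image.1 hQ
  exact disjoint_comp_of_ne hPQ

/-! ### Labels of grown halves and the potential of a cluster -/

/-- The **label** of a half along the axis `i`: the `i`-th coordinate of the tail of its link, and its side.
[cite: DelfosseNickerson2021, §3 proof of Thm 1 (the extent of a cluster along a logical cycle)] -/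
def lab (i : Fin 2) (h : Half L) : ZMod L × Bool := (h.1.1 i, h.2)

/-- The axis-`i` labels carried by the grown halves sitting at the sites of `K`.
[cite: DelfosseNickerson2021, §3 proof of Thm 1 (the columns met by a cluster)] -/
def labels (i : Fin 2) (S : Finset (Half L)) (K : Finset (Vertex L)) : Finset (ZMod L × Bool) :=
  ((S.filter fun h => h.1.2 = i).filter fun h => h.vert ∈ K).image (lab i)

/-- The **credit** of `K`: grown halves of un-erased error links sitting at sites of `K`.
[cite: DelfosseNickerson2021, §3 proof of Thm 1 ("each growth step covers at least half an edge of error")] -/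
def credit (e : Chain L) (R : Finset (Edge L)) (S : Finset (Half L)) (K : Finset (Vertex L)) : ℕ :=
  ((S.filter fun h => e h.1 ≠ 0 ∧ h.1 ∉ R).filter fun h => h.vert ∈ K).card

/-- The number of erased axis-`i` links with tail in `K`. [cite: DelfosseNickerson2021, §3 proof of Thm 1 (the erased part of a cluster)] -/
def erased (i : Fin 2) (R : Finset (Edge L)) (K : Finset (Vertex L)) : ℕ :=
  ((R.filter fun ℓ => ℓ.2 = i).filter fun ℓ => tail ℓ ∈ K).card

/-- **The potential invariant**: along each axis, every cluster carries at most `2·credit + 2·erased`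
distinct labels — the certified form of DN21's "a cluster of radius `r` has absorbed `r` half-edges of
error or erasure in every direction it spans". [cite: DelfosseNickerson2021, §3 proof of Thm 1] -/
def PotInv (e : Chain L) (R : Finset (Edge L)) (S : Finset (Half L)) : Prop :=
  ∀ v i, (labels i S (comp S v)).card ≤ 2 * credit e R S (comp S v) + 2 * erased i R (comp S v)

omit [NeZero L] in
/-- The label of a grown half sitting in `K` is a label of `K`. [cite: DelfosseNickerson2021, §3 proof of Thm 1] -/
theorem lab_mem_labels {S : Finset (Half L)} {K : Finset (Vertex L)} {i : Fin 2} {h : Half L} (hS : h ∈ S)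
    (hi : h.1.2 = i) (hv : h.vert ∈ K) : lab i h ∈ labels i S K :=
  Finset.mem_image.2 ⟨h, Finset.mem_filter.2 ⟨Finset.mem_filter.2 ⟨hS, hi⟩, hv⟩, rfl⟩

/-- A label missing from a cluster forbids the full axis-`i` links of that cluster from the corresponding
column. [cite: DelfosseNickerson2021, §3 proof of Thm 1] -/
theorem tail_apply_ne_of_not_mem_labels {S : Finset (Half L)} {x : Vertex L} {i : Fin 2} {a : ZMod L} {b : Bool}
    (hn : (a, b) ∉ labels i S (comp S x)) {ℓ : Edge L} (hf : IsFull S ℓ) (hi : ℓ.2 = i)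
    (ht : tail ℓ ∈ comp S x) : ℓ.1 i ≠ a := by
  rintro rfl
  apply hn
  have hv : Half.vert (ℓ, b) ∈ comp S x := by
    cases b
    · rwa [vert_mk_false]
    · rw [vert_mk_true]; exact (tail_mem_comp_iff_head_mem_comp hf x).1 ht
  have hS : (ℓ, b) ∈ S := by cases b; exacts [hf.1, hf.2]
  exact lab_mem_labels hS hi hv

/-- **At most one new label per side.** Two halves grown in one round by sites `π h, π h'` of the same
cluster, on the same side, whose labels are both new for that cluster, carry the same label: otherwise the
cluster would have to cross one of the two seams next to the new columns (seam lemma).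
[cite: DelfosseNickerson2021, §3 proof of Thm 1 (a cluster grows by half an edge in each direction per round)] -/
theorem lab_eq_of_new {S : Finset (Half L)} {i : Fin 2} {x : Vertex L} {π : Half L → Vertex L} {δ : ZMod L}
    (hδ : δ = 0 ∨ δ = 1) {h h' : Half L} (hπ : π h ∈ comp S x) (hπ' : π h' ∈ comp S x)
    (hco : (π h) i = h.1.1 i + δ) (hco' : (π h') i = h'.1.1 i + δ) (hb : h.2 = h'.2)
    (hnew : lab i h ∉ labels i S (comp S x)) (hnew' : lab i h' ∉ labels i S (comp S x)) :
    lab i h = lab i h' := by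
  unfold lab at hnew hnew' ⊢
  rw [hb]
  by_contra hne
  have haa : h.1.1 i ≠ h'.1.1 i := fun heq => hne (by rw [heq])
  rw [hb] at hnew
  have hforbid : ∀ ℓ : Edge L, IsFull S ℓ → ℓ.2 = i → tail ℓ ∈ comp S x →
      ℓ.1 i ≠ h.1.1 i ∧ ℓ.1 i ≠ h'.1.1 i := fun ℓ hf hi ht =>
    ⟨tail_apply_ne_of_not_mem_labels hnew hf hi ht, tail_apply_ne_of_not_mem_labels hnew' hf hi ht⟩
  have h1 := inArc_iff_of_mem_comp hπ hforbid
  have h2 := inArc_iff_of_mem_comp hπ' hforbid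
  rw [hco] at h1
  rw [hco', ← h1] at h2
  rcases hδ with rfl | rfl
  · rw [add_zero, add_zero] at h2
    exact not_inArc_left _ _ (h2.1 (inArc_right haa))
  · exact not_inArc_right_add_one _ _ (h2.2 (inArc_left_add_one haa))

omit [NeZero L] in
/-- A set of labels with at most one label per side has at most two elements. [folklore] -/
private theorem card_le_two_of_side {T : Finset (ZMod L × Bool)} (h : ∀ y ∈ T, ∀ y' ∈ T, y.2 = y'.2 → y = y') :
    T.card ≤ 2 := by
  calc T.card ≤ (univ : Finset Bool).card :=
        Finset.card_le_card_of_injOn Prod.snd (fun _ _ => Finset.mem_coe.2 (Finset.mem_univ _))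
          fun y hy y' hy' hyy' => h y hy y' hy' hyy'
    _ = 2 := by simp

/-- **The potential invariant holds initially**: the labels of a cluster of the erasure come from its erased
links, two per link. [cite: DelfosseNickerson2021, §3 proof of Thm 1 (initial clusters = erasure)] -/
theorem potInv_initial (e : Chain L) (R : Finset (Edge L)) : PotInv e R (initial R) := by
  classical
  intro v i
  set K := comp (initial R) v
  set A := ((initial R).filter fun h => h.1.2 = i).filter fun h => h.vert ∈ K
  have h1 : (labels i (initial R) K).card ≤ A.card := Finset.card_image_le
  have h2 : A.card ≤ 2 * (A.image Prod.fst).card := by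
    refine Finset.card_le_mul_card_image A 2 fun ℓ _ => ?_
    calc ({a ∈ A | a.1 = ℓ} : Finset (Half L)).card ≤ (univ : Finset Bool).card :=
          Finset.card_le_card_of_injOn Prod.snd (fun _ _ => Finset.mem_coe.2 (Finset.mem_univ _))
            fun y hy y' hy' hyy' => by
              have e1 := (Finset.mem_filter.1 (Finset.mem_coe.1 hy)).2
              have e2 := (Finset.mem_filter.1 (Finset.mem_coe.1 hy')).2
              exact Prod.ext (e1.trans e2.symm) hyy'
      _ = 2 := by simp
  have h3 : (A.image Prod.fst).card ≤ erased i R K := by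
    refine Finset.card_le_card fun ℓ hℓ => ?_
    obtain ⟨a, ha, rfl⟩ := Finset.mem_image.1 hℓ
    obtain ⟨ha', hv⟩ := Finset.mem_filter.1 ha
    obtain ⟨hini, hi⟩ := Finset.mem_filter.1 ha'
    have hR : a.1 ∈ R := mem_initial.1 hini
    refine Finset.mem_filter.2 ⟨Finset.mem_filter.2 ⟨hR, hi⟩, ?_⟩
    rcases a with ⟨ℓ, b⟩
    cases b
    · rwa [vert_mk_false] at hv
    · rw [vert_mk_true] at hv
      exact (tail_mem_comp_iff_head_mem_comp (isFull_initial_iff.2 hR) v).2 hv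
  unfold erased at h3
  unfold erased
  omega

/-- The other half of a full link sits in the same cluster. [cite: DelfosseNickerson2021, §2 Algorithm 1 (step 5)] -/
theorem other_vert_mem_comp {S : Finset (Half L)} {h : Half L} (hf : IsFull S h.1) :
    h.other.vert ∈ comp S h.vert := by
  rcases h with ⟨ℓ, b⟩
  cases b
  · simp only [Half.other, Bool.not_false, vert_mk_true, vert_mk_false]
    exact (tail_mem_comp_iff_head_mem_comp hf (tail ℓ)).1 (mem_comp_self S _)
  · simp only [Half.other, Bool.not_true, vert_mk_false, vert_mk_true]
    exact (tail_mem_comp_iff_head_mem_comp hf (head ℓ)).2 (mem_comp_self S _)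

/-- **The potential invariant survives a round** (abstract form). The round `S ⊆ S'` is described by a
"producer" map `π` (the acting site responsible for a new half: the half's own site in a near-type round,
the site across the link in a far-type round) with a fixed coordinate offset `δ` per side; every odd cluster
produces a new half on an un-erased error link (`hwit`, the credit), and — by the seam lemma — at most one
new label per side. Summing over the old clusters fused into a new one gives the invariant for `S'`.
[cite: DelfosseNickerson2021, §3 proof of Thm 1] -/
theorem potInv_of_round {e : Chain L} {R : Finset (Edge L)} {σ : Syndrome L} {S S' : Finset (Half L)}
    (hSS' : S ⊆ S') (hpot : PotInv e R S) (π : Half L → Vertex L) (δ : Bool → ZMod L)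
    (hδ : ∀ b, δ b = 0 ∨ δ b = 1) (hco : ∀ h : Half L, (π h) h.1.2 = h.1.1 h.1.2 + δ h.2)
    (hnew : ∀ h ∈ S', h ∉ S → charge σ S (π h) = 1 ∧ π h ∈ comp S' h.vert)
    (hwit : ∀ x, charge σ S x = 1 → ∃ h ∈ S', h ∉ S ∧ (e h.1 ≠ 0 ∧ h.1 ∉ R) ∧ π h ∈ comp S x) :
    PotInv e R S' := by
  classical
  intro v i
  set K' := comp S' v with hK'
  set Ps := K'.image (comp S) with hPs
  have hPsub : ∀ P ∈ Ps, P ⊆ K' := by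
    intro P hP
    obtain ⟨w, hw, rfl⟩ := Finset.mem_image.1 hP
    rw [hK', ← comp_eq_comp_of_mem hw]
    exact comp_mono hSS' w
  have hdisj := pairwiseDisjoint_image_comp S K'
  -- the new-cluster bookkeeping sets
  set Odd : Finset (Vertex L) → Prop := fun P => (∑ u ∈ P, σ u) = 1 with hOdd
  set NEWH := (S' \ S).filter fun h => h.1.2 = i with hNEWH
  set NEW : Finset (Vertex L) → Finset (ZMod L × Bool) := fun P => (NEWH.filter fun h => π h ∈ P).image (lab i)
    with hNEW
  set OLDL := Ps.biUnion (labels i S) with hOLDL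
  set NEWL := (Ps.filter Odd).biUnion fun P => NEW P \ labels i S P with hNEWL
  set NEWOUT := (S' \ S).filter fun h => (e h.1 ≠ 0 ∧ h.1 ∉ R) ∧ h.vert ∈ K' with hNEWOUT
  -- a new half attached to `K'` has its producer's old cluster among the pieces of `K'`
  have hprod : ∀ h ∈ S', h ∉ S → h.vert ∈ K' → comp S (π h) ∈ Ps ∧ Odd (comp S (π h)) := by
    intro h hS' hS hv
    obtain ⟨h1, hπ⟩ := hnew h hS' hS
    have hπK : π h ∈ K' := by
      rw [hK', ← comp_eq_comp_of_mem hv]; exact hπ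
    exact ⟨Finset.mem_image_of_mem _ hπK, h1⟩
  -- Claim 1: every label of `K'` is an old label of a piece or a new label of an odd piece
  have hcl1 : labels i S' K' ⊆ OLDL ∪ NEWL := by
    intro y hy
    obtain ⟨h, hh, rfl⟩ := Finset.mem_image.1 hy
    obtain ⟨hh', hv⟩ := Finset.mem_filter.1 hh
    obtain ⟨hS', hi⟩ := Finset.mem_filter.1 hh'
    rw [Finset.mem_union]
    by_cases hS : h ∈ S
    · left
      exact Finset.mem_biUnion.2 ⟨comp S h.vert, Finset.mem_image_of_mem _ hv,
        lab_mem_labels hS hi (mem_comp_self S _)⟩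
    · obtain ⟨hP, hodd⟩ := hprod h hS' hS hv
      by_cases hyo : lab i h ∈ labels i S (comp S (π h))
      · exact Or.inl (Finset.mem_biUnion.2 ⟨_, hP, hyo⟩)
      · right
        refine Finset.mem_biUnion.2 ⟨_, Finset.mem_filter.2 ⟨hP, hodd⟩, Finset.mem_sdiff.2 ⟨?_, hyo⟩⟩
        exact Finset.mem_image.2 ⟨h, Finset.mem_filter.2
          ⟨Finset.mem_filter.2 ⟨Finset.mem_sdiff.2 ⟨hS', hS⟩, hi⟩, mem_comp_self S _⟩, rfl⟩
  -- Claim 2: an odd piece contributes at most two new labels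
  have hcl2 : ∀ P ∈ Ps.filter Odd, (NEW P \ labels i S P).card ≤ 2 := by
    intro P hP
    obtain ⟨w, -, rfl⟩ := Finset.mem_image.1 (Finset.mem_filter.1 hP).1
    refine card_le_two_of_side fun y hy y' hy' hyy' => ?_
    obtain ⟨hy, hyn⟩ := Finset.mem_sdiff.1 hy
    obtain ⟨hy', hyn'⟩ := Finset.mem_sdiff.1 hy'
    obtain ⟨h, hh, rfl⟩ := Finset.mem_image.1 hy
    obtain ⟨h', hh', rfl⟩ := Finset.mem_image.1 hy'
    obtain ⟨hh1, hπ⟩ := Finset.mem_filter.1 hh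
    obtain ⟨hh1', hπ'⟩ := Finset.mem_filter.1 hh'
    have hi : h.1.2 = i := (Finset.mem_filter.1 hh1).2
    have hi' : h'.1.2 = i := (Finset.mem_filter.1 hh1').2
    have hb : h.2 = h'.2 := hyy'
    have hc := hco h
    have hc' := hco h'
    rw [hi] at hc
    rw [hi', ← hb] at hc'
    exact lab_eq_of_new (hδ h.2) hπ hπ' hc hc' hb hyn hyn'
  -- Claim 3: at least one new out-half per odd piece
  have hcl3 : (Ps.filter Odd).card ≤ NEWOUT.card := by
    refine le_trans (Finset.card_le_card fun P hP => ?_) (Finset.card_image_le (f := fun h => comp S (π h)))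
    obtain ⟨hP, hodd⟩ := Finset.mem_filter.1 hP
    obtain ⟨w, hw, rfl⟩ := Finset.mem_image.1 hP
    obtain ⟨h, hS', hS, hout, hπ⟩ := hwit w hodd
    refine Finset.mem_image.2 ⟨h, Finset.mem_filter.2 ⟨Finset.mem_sdiff.2 ⟨hS', hS⟩, hout, ?_⟩,
      comp_eq_comp_of_mem hπ⟩
    -- the new half sits in `K'`
    obtain ⟨-, hπ'⟩ := hnew h hS' hS
    have hπK : π h ∈ K' := by
      rw [hK', ← comp_eq_comp_of_mem hw]; exact comp_mono hSS' w hπ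
    have hcomp : comp S' h.vert = K' := by
      rw [← comp_eq_comp_of_mem hπ', hK', comp_eq_comp_of_mem hπK]
    rw [← hcomp]
    exact mem_comp_self S' _
  -- Claim 4: credits add up, plus the new out-halves
  have hcl4 : ∑ P ∈ Ps, credit e R S P + NEWOUT.card ≤ credit e R S' K' := by
    set T := S.filter fun h => e h.1 ≠ 0 ∧ h.1 ∉ R with hT
    set T' := T.filter fun h => h.vert ∈ K' with hT'
    have hsum : ∑ P ∈ Ps, credit e R S P ≤ T'.card :=
      sum_card_filter_mem_le Ps hdisj Half.vert T T' fun a ha P hP haP =>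
        Finset.mem_filter.2 ⟨ha, hPsub P hP haP⟩
    have hdj : Disjoint T' NEWOUT := by
      rw [Finset.disjoint_left]
      intro a ha ha'
      have h1 : a ∈ S := (Finset.mem_filter.1 (Finset.mem_filter.1 ha).1).1
      exact (Finset.mem_sdiff.1 (Finset.mem_filter.1 ha').1).2 h1
    have hsub : T' ∪ NEWOUT ⊆ (S'.filter fun h => e h.1 ≠ 0 ∧ h.1 ∉ R).filter fun h => h.vert ∈ K' := by
      intro a ha
      rcases Finset.mem_union.1 ha with ha | ha
      · obtain ⟨ha1, hv⟩ := Finset.mem_filter.1 ha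
        obtain ⟨hS, hout⟩ := Finset.mem_filter.1 ha1
        exact Finset.mem_filter.2 ⟨Finset.mem_filter.2 ⟨hSS' hS, hout⟩, hv⟩
      · obtain ⟨ha1, hout, hv⟩ := Finset.mem_filter.1 ha
        exact Finset.mem_filter.2 ⟨Finset.mem_filter.2 ⟨(Finset.mem_sdiff.1 ha1).1, hout⟩, hv⟩
    have hcard := Finset.card_le_card hsub
    rw [Finset.card_union_of_disjoint hdj] at hcard
    have hdef : credit e R S' K' = ((S'.filter fun h => e h.1 ≠ 0 ∧ h.1 ∉ R).filter fun h => h.vert ∈ K').card := rfl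
    rw [hdef]
    omega
  -- Claim 5: erased links add up
  have hcl5 : ∑ P ∈ Ps, erased i R P ≤ erased i R K' := by
    refine sum_card_filter_mem_le Ps hdisj tail _ _ fun a ha P hP haP => ?_
    exact Finset.mem_filter.2 ⟨ha, hPsub P hP haP⟩
  -- Claim 6: the invariant for the pieces
  have hcl6 : OLDL.card ≤ 2 * ∑ P ∈ Ps, credit e R S P + 2 * ∑ P ∈ Ps, erased i R P := by
    refine Finset.card_biUnion_le.trans ?_
    rw [Finset.mul_sum, Finset.mul_sum, ← Finset.sum_add_distrib]
    refine Finset.sum_le_sum fun P hP => ?_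
    obtain ⟨w, -, rfl⟩ := Finset.mem_image.1 hP
    exact hpot w i
  have hcl7 : NEWL.card ≤ 2 * (Ps.filter Odd).card := by
    refine Finset.card_biUnion_le.trans ?_
    rw [mul_comm, ← smul_eq_mul, ← Finset.sum_const]
    exact Finset.sum_le_sum hcl2
  have hA := (Finset.card_le_card hcl1).trans (Finset.card_union_le OLDL NEWL)
  omega

/-- **The potential invariant survives a round of Algorithm 1.** [cite: DelfosseNickerson2021, §3 proof of Thm 1] -/
theorem potInv_step {e : Chain L} {R : Finset (Edge L)} {S : Finset (Half L)} (hR : ∀ ℓ ∈ R, IsFull S ℓ)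
    (hsync : SyncInv (syn L e) S) (hpot : PotInv e R S) : PotInv e R (step (syn L e) S) := by
  rcases hsync.1 with hN | hF
  · -- near-type round: the producer of a new half is its own site
    refine potInv_of_round (σ := syn L e) (subset_step _ S) hpot Half.vert (fun b => if b then 1 else 0)
      (fun b => by cases b <;> simp) (fun h => ?_) (fun h hS' hS => ?_) (fun x hx => ?_)
    · rcases h with ⟨⟨t, j⟩, b⟩
      cases b
      · simp [tail]
      · simp [head_apply_self]
    · exact ⟨(near_new hN hS' hS).1, mem_comp_self _ _⟩
    · obtain ⟨u, hu, h₀, hh₀, he, hR₀, hfull, hS', hS⟩ := exists_new_errHalf hR hx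
      have hux : charge (syn L e) S u = 1 := by rw [charge_eq_of_mem_comp hu, hx]
      have h₀S : h₀ ∉ S := hN u hux h₀ hh₀ hfull
      rw [act, if_neg h₀S] at hS' hS
      exact ⟨h₀, hS', hS, ⟨he, hR₀⟩, by rwa [mem_slots_iff.1 hh₀]⟩
  · -- far-type round: the producer of a new half is the site across its link
    refine potInv_of_round (σ := syn L e) (subset_step _ S) hpot (fun h => h.other.vert) (fun b => if b then 0 else 1)
      (fun b => by cases b <;> simp) (fun h => ?_) (fun h hS' hS => ?_) (fun x hx => ?_)
    · rcases h with ⟨⟨t, j⟩, b⟩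
      cases b
      · simp [Half.other, head_apply_self]
      · simp [Half.other, tail]
    · obtain ⟨h1, h2, -⟩ := far_new hF hS' hS
      exact ⟨h1, other_vert_mem_comp (isFull_iff_mem_and_other_mem.2 ⟨hS', subset_step _ S h2⟩)⟩
    · obtain ⟨u, hu, h₀, hh₀, he, hR₀, hfull, hS', hS⟩ := exists_new_errHalf hR hx
      have hux : charge (syn L e) S u = 1 := by rw [charge_eq_of_mem_comp hu, hx]
      have h₀S : h₀ ∈ S := hF u hux h₀ hh₀ hfull
      rw [act, if_pos h₀S] at hS' hS
      refine ⟨h₀.other, hS', hS, ⟨by simpa using he, by simpa using hR₀⟩, ?_⟩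
      simp only [Half.other_other]
      rwa [mem_slots_iff.1 hh₀]

/-- **The potential invariant holds after every round, in particular in the final state.**
[cite: DelfosseNickerson2021, §3 proof of Thm 1] -/
theorem potInv_state (e : Chain L) (R : Finset (Edge L)) : ∀ n, PotInv e R (state (syn L e) R n)
  | 0 => potInv_initial e R
  | n + 1 => by
    rw [state_succ]
    exact potInv_step (fun ℓ hℓ => (isFull_initial_iff.2 hℓ).mono (initial_subset_state _ R n))
      (syncInv_state _ R n) (potInv_state e R n)

/-! ### Theorem 1 of Delfosse–Nickerson for the toric code -/

/-- **Delfosse–Nickerson 2021, Theorem 1, for the `L × L` toric code.** If the erasure `R` (`t = |R|`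
links) and the `Z`-error `e` (`s` = number of error links OUTSIDE the erasure) satisfy `t + 2s < L`, then
EVERY valid output `C` of the Union-Find decoder (Algorithm 1 followed by any peeling inside the grown
erasure) corrects `e`: `e + C` is a boundary. ("Theorem 1. If `t + 2s < d`, Algorithm 1 can correct any
combination of `t` erased qubits and `s` Z-error"; here `d = L`, `ToricCode.cycle_weight_ge`.) The printed
proof's covering claim ("the grown clusters cover the error") is replaced by the potential/seam argument of
this file; errors inside the erasure are free, as in the source.
[cite: DelfosseNickerson2021, §3 Theorem 1] -/
theorem DelfosseNickerson2021_theorem1_toric (e : Chain L) (R : Finset (Edge L))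
    (ht : R.card + 2 * (supp e \ R).card < L) {C : Chain L} (hC : IsOutput (syn L e) R C) :
    e + C ∈ boundaries L := by
  classical
  by_contra hnb
  set S := final (syn L e) R with hS
  have hpot : PotInv e R S := potInv_state e R _
  obtain ⟨i, hi⟩ : ∃ i : Fin 2, ∀ a : ZMod L, ∃ v : Vertex L, v i = a ∧ (e + C) (v, i) ≠ 0 := by
    rcases forall_col_or_forall_row_of_not_mem_boundaries hC.add_mem_cycles hnb with h | h
    exacts [⟨0, h⟩, ⟨1, h⟩]
  choose f hf using hi
  set Eout := supp e \ R with hEout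
  -- a link of the net cycle is full or an un-erased error link
  have hlink : ∀ ℓ, (e + C) ℓ ≠ 0 → ¬ IsFull S ℓ → ℓ ∈ Eout := by
    intro ℓ hℓ hfull
    have hCℓ : C ℓ = 0 := by
      by_contra hCℓ; exact hfull (hC.1 ℓ hCℓ)
    have heℓ : e ℓ ≠ 0 := by simpa [Pi.add_apply, hCℓ] using hℓ
    refine Finset.mem_sdiff.2 ⟨?_, fun hR => hfull (isFull_final_of_mem hR)⟩
    simpa [supp] using heℓ
  -- the probe halves `φ (a, b) = ((f a, i), b)`, one per column and side
  set φ : ZMod L × Bool → Half L := fun p => ((f p.1, i), p.2) with hφ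
  have hφinj : Function.Injective φ := by
    rintro ⟨a, b⟩ ⟨a', b'⟩ h
    simp only [hφ, Prod.mk.injEq] at h
    obtain ⟨⟨hv, -⟩, hb⟩ := h
    have : a = a' := by rw [← (hf a).1, ← (hf a').1, hv]
    rw [this, hb]
  set U₁ := (univ : Finset (ZMod L × Bool)).filter fun p => φ p ∈ S with hU₁
  set U₂ := (univ : Finset (ZMod L × Bool)).filter fun p => ¬ φ p ∈ S with hU₂
  have hU : U₁.card + U₂.card = 2 * L := by
    rw [hU₁, hU₂, Finset.card_filter_add_card_filter_not, Finset.card_univ, Fintype.card_prod,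
      ZMod.card, Fintype.card_bool, mul_comm]
  -- grown probe halves are labels of clusters
  set Ks := (univ : Finset (Vertex L)).image (comp S) with hKs
  have h1 : U₁ ⊆ Ks.biUnion (labels i S) := by
    intro p hp
    have hpS : φ p ∈ S := (Finset.mem_filter.1 hp).2
    refine Finset.mem_biUnion.2 ⟨comp S (φ p).vert, Finset.mem_image_of_mem _ (Finset.mem_univ _), ?_⟩
    have hlab : lab i (φ p) = p := by
      rcases p with ⟨a, b⟩
      simp only [lab, hφ, (hf a).1]
    have hmem := lab_mem_labels (K := comp S (φ p).vert) hpS rfl (mem_comp_self S _)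
    rwa [hlab] at hmem
  have h1' : U₁.card ≤ ∑ K ∈ Ks, (labels i S K).card :=
    (Finset.card_le_card h1).trans Finset.card_biUnion_le
  have hKpot : ∑ K ∈ Ks, (labels i S K).card ≤
      2 * ∑ K ∈ Ks, credit e R S K + 2 * ∑ K ∈ Ks, erased i R K := by
    rw [Finset.mul_sum, Finset.mul_sum, ← Finset.sum_add_distrib]
    refine Finset.sum_le_sum fun K hK => ?_
    obtain ⟨w, -, rfl⟩ := Finset.mem_image.1 hK
    exact hpot w i
  have hdisj := pairwiseDisjoint_image_comp S (univ : Finset (Vertex L))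
  -- total credit = grown out-halves `G`; total erased ≤ t
  set Gset := S.filter fun h => e h.1 ≠ 0 ∧ h.1 ∉ R with hGset
  have hcredit : ∑ K ∈ Ks, credit e R S K ≤ Gset.card :=
    sum_card_filter_mem_le Ks hdisj Half.vert _ Gset fun a ha _ _ _ => ha
  have herased0 : ∑ K ∈ Ks, erased i R K ≤ (R.filter fun ℓ => ℓ.2 = i).card :=
    sum_card_filter_mem_le Ks hdisj tail _ _ fun a ha _ _ _ => ha
  have herased : ∑ K ∈ Ks, erased i R K ≤ R.card := herased0.trans (Finset.card_filter_le _ _)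
  -- bare probe halves are bare out-halves
  set B := (univ : Finset (Half L)).filter fun h => h.1 ∈ Eout ∧ h ∉ S with hB
  have h2 : U₂.card ≤ B.card := by
    refine Finset.card_le_card_of_injOn φ (fun p hp => ?_) (hφinj.injOn)
    have hpS : φ p ∉ S := (Finset.mem_filter.1 (Finset.mem_coe.1 hp)).2
    refine Finset.mem_coe.2 (Finset.mem_filter.2 ⟨Finset.mem_univ _, ?_, hpS⟩)
    refine hlink _ (hf p.1).2 fun hfull => hpS ?_
    rcases p with ⟨a, b⟩
    cases b
    exacts [hfull.1, hfull.2]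
  -- halves of out-links: grown ones are `Gset`, bare ones are `B`; together `2s`
  have hGB : Gset.card + B.card = 2 * Eout.card := by
    have hG' : Gset = ((univ : Finset (Half L)).filter fun h => h.1 ∈ Eout).filter fun h => h ∈ S := by
      ext h
      simp only [hGset, hEout, supp, Finset.mem_filter, Finset.mem_univ, true_and, Finset.mem_sdiff]
      tauto
    have hB' : B = ((univ : Finset (Half L)).filter fun h => h.1 ∈ Eout).filter fun h => ¬ h ∈ S := by
      ext h
      simp only [hB, Finset.mem_filter, Finset.mem_univ, true_and]
    rw [hG', hB', Finset.card_filter_add_card_filter_not]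
    have : ((univ : Finset (Half L)).filter fun h => h.1 ∈ Eout) = Eout ×ˢ (univ : Finset Bool) := by
      ext ⟨ℓ, b⟩
      simp
    rw [this, Finset.card_product, Finset.card_univ, Fintype.card_bool, mul_comm]
  have hG : Gset.card ≤ 2 * Eout.card := by omega
  omega

/-- **Corollary: the Union-Find decoder corrects every such error.** With `t + 2s < L` the decoder
`ufDecoder R` (Algorithm 1 with some fixed peeling choice) corrects `e` in the sense of
`Decoder.Corrects` (the DKLP success criterion `D(∂e) + e ∈ boundaries`).
[cite: DelfosseNickerson2021, §3 Theorem 1] -/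
theorem ufDecoder_corrects (R : Finset (Edge L)) (e : Chain L) (ht : R.card + 2 * (supp e \ R).card < L) :
    (ufDecoder R).Corrects (syn L) (boundaries L) e := by
  rw [ufDecoder_corrects_iff, add_comm]
  exact DelfosseNickerson2021_theorem1_toric e R ht (isOutput_ufDecoder R e)

/-- **Without erasure the Union-Find decoder corrects every `Z`-error of weight `≤ ⌊(L-1)/2⌋`** (`2s < L`).
[cite: DelfosseNickerson2021, §3 Theorem 1 (t = 0) and ¶2 ("can correct any error configuration of weight up to ⌊(d-1)/2⌋")] -/
theorem ufDecoder_correctsUpTo :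
    (ufDecoder (∅ : Finset (Edge L))).CorrectsUpTo (syn L) (boundaries L) hammingNorm ((L - 1) / 2) := by
  intro e he
  apply ufDecoder_corrects
  have hcard : (supp e \ ∅).card = hammingNorm e := by rw [Finset.sdiff_empty]; rfl
  rw [Finset.card_empty, hcard]
  have := NeZero.ne L
  omega

/-- **The Union-Find decoder attains the optimal `Z`-correction radius `⌊(L-1)/2⌋` of the toric code** (no
decoder does better, `ToricCode.optimalRadiusZ`). [cite: DelfosseNickerson2021, §3 ¶2 and Theorem 1] -/
theorem ufDecoder_isCorrectionRadius :
    (ufDecoder (∅ : Finset (Edge L))).IsCorrectionRadius (syn L) (boundaries L) hammingNorm ((L - 1) / 2) := by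
  refine ⟨ufDecoder_correctsUpTo, fun h => ?_⟩
  have := (optimalRadiusZ (L := L)).2 _ _ h
  omega

end UnionFind

end ToricCode

end Literature.InformationTheory.QuantumCodes
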